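import Literature.Algebra.EuclideanLattices.LLLIntegral
import HarnessLib

/-!
# The saturated integral LLL step (functional model of the LLL machine)

Trunk: Lattice; sibling of `LLLIntegral.lean` on the way to the machine-level fact
`Literature.Algebra.EuclideanLattices.lllReduce_polyTime`. The stack machine for LLL (to be filed as `LLLMachine*.lean`
under `Literature/Computability/Complexity/`; not yet in the tree) runs Cohen's integral LLL
(Cohen 1993, Algorithm 2.6.7; `intStep`) but, in order to have register lengths bounded
polynomially on *every* input word (not only on codes of lattice bases, where LLL82's analysis
applies), it **saturates**: every integer it stores is replaced by `0` as soon as it has `≥ 2^W`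
in absolute value (`capZ W`), for a width `W` polynomial in the input length. This file is the
exact functional model of that machine at the level of `Fin`-indexed integer matrices:

* `capZ`, `capVec`; `uRecCap`, `dRecCap` — Cohen's recursion (`uRec`, `dRec`) with `capZ` after
  every step; `sizeReduceCap`, `sizeReduceFromCap`, `capStep` — `intSizeReduce`,
  `intSizeReduceFrom`, `intStep` computed from the capped tables, with the new row capped;
* `ℕ`-indexed list views used in the machine's loop invariants: `uCapN`, `rowN`, `rowsFromN`,
  `lamRowN`, `lamFlatN`, `dListN`;
* agreement with the uncapped quantities when everything the machine stores is short:
  `FitsU` (all `uₗ(i,j)`, `l ≤ j ≤ i`, have absolute value `< 2^W` — this triangular index set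
  is closed under the recursion), `uRecCap_eq_uRec`, `dRecCap_eq_dRec`,
  `sizeReduceCap_eq_intSizeReduce`, and `capStep_eq_intStep` under the hypothesis that every
  matrix met during the pass (`intPassMatrices`: the current one, the one after `RED(k,k-1)`,
  and those of the descending loop, `intRedChain`) fits (`Fits`). That lattice bases along the
  run fit for `W = O(n log B)` is LLL82's size analysis (Prop. 1.26, proof; `lll_norm_sq_le`)
  and is not proved in this file.

## References

* H. Cohen, *A Course in Computational Algebraic Number Theory*, GTM 138, 1993, Algorithm 2.6.7.
* A. K. Lenstra, H. W. Lenstra Jr., L. Lovász, Math. Ann. 261 (1982), Prop. 1.26 (all integers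
  met by the algorithm have binary length `O(n log B)`).
-/

namespace Literature.Algebra.EuclideanLattices

open Function

section Cap

/-- **Saturation at width `W`**: integers of absolute value `≥ 2^W` become `0`. [folklore] -/
def capZ (W : ℕ) (z : ℤ) : ℤ := if z.natAbs < 2 ^ W then z else 0

/-- `capZ` is the identity on short integers. [folklore] -/
theorem capZ_of_lt {W : ℕ} {z : ℤ} (h : z.natAbs < 2 ^ W) : capZ W z = z := if_pos h

/-- A capped integer is short. [folklore] -/
theorem natAbs_capZ_lt (W : ℕ) (z : ℤ) : (capZ W z).natAbs < 2 ^ W := by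
  unfold capZ; split_ifs with h
  · exact h
  · simp

/-- `capZ W 0 = 0`. [folklore] -/
@[simp] theorem capZ_zero (W : ℕ) : capZ W 0 = 0 := by simp [capZ]

variable {n m : ℕ}

/-- Capping a vector entrywise. [folklore] -/
def capVec (W : ℕ) (v : Fin m → ℤ) : Fin m → ℤ := fun t => capZ W (v t)

/-- **Cohen's recursion, saturated**: `uRec` with `capZ W` applied after every step (and to the
Gram entries). [cite: Cohen1993, Cor. 2.6.6 and Algorithm 2.6.7 Step 2] -/
def uRecCap (W : ℕ) (b : Fin n → (Fin m → ℤ)) : ℕ → Fin n → Fin n → ℤ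
  | 0, i, j => capZ W (intGram b i j)
  | l + 1, i, j =>
    if h : l < n then
      capZ W ((uRecCap W b l ⟨l, h⟩ ⟨l, h⟩ * uRecCap W b l i j -
          uRecCap W b l j ⟨l, h⟩ * uRecCap W b l i ⟨l, h⟩) /
        (if l = 0 then 1 else uRecCap W b (l - 1) ⟨l - 1, by omega⟩ ⟨l - 1, by omega⟩))
    else 0
termination_by l => l
decreasing_by all_goals omega

/-- The saturated `d`-list: `d₀ = 1`, `dₗ₊₁ = uₗ(l,l)`. [cite: Cohen1993, Algorithm 2.6.7] -/
def dRecCap (W : ℕ) (b : Fin n → (Fin m → ℤ)) : ℕ → ℤ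
  | 0 => 1
  | l + 1 => if h : l < n then uRecCap W b l ⟨l, h⟩ ⟨l, h⟩ else 0

/-- Unfolding `uRecCap` at `0`. [folklore] -/
theorem uRecCap_zero (W : ℕ) (b : Fin n → (Fin m → ℤ)) (i j : Fin n) :
    uRecCap W b 0 i j = capZ W (intGram b i j) := by
  rw [uRecCap]

/-- `dRecCap` at `0`. [folklore] -/
@[simp] theorem dRecCap_zero (W : ℕ) (b : Fin n → (Fin m → ℤ)) : dRecCap W b 0 = 1 := rfl

/-- `dRecCap` at a successor. [folklore] -/
theorem dRecCap_succ (W : ℕ) (b : Fin n → (Fin m → ℤ)) (l : Fin n) :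
    dRecCap W b (l + 1) = uRecCap W b l l l := by
  simp [dRecCap, l.isLt]

/-- Unfolding `uRecCap` at a successor. [folklore] -/
theorem uRecCap_succ (W : ℕ) (b : Fin n → (Fin m → ℤ)) (l : Fin n) (i j : Fin n) :
    uRecCap W b (l + 1) i j =
      capZ W ((uRecCap W b l l l * uRecCap W b l i j - uRecCap W b l j l * uRecCap W b l i l) / dRecCap W b l) := by
  rw [uRecCap, dif_pos l.isLt]
  congr 2
  obtain ⟨lv, hlv⟩ := l
  cases lv with
  | zero => simp [dRecCap]
  | succ l' => simp [dRecCap, show l' < n by omega]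

/-- `uRecCap` beyond `n` is junk `0`. [folklore] -/
theorem uRecCap_of_le (W : ℕ) (b : Fin n → (Fin m → ℤ)) {l : ℕ} (hl : n ≤ l) (i j : Fin n) :
    uRecCap W b (l + 1) i j = 0 := by
  rw [uRecCap, dif_neg (by omega)]

/-- Every capped value is short. [folklore] -/
theorem natAbs_uRecCap_lt (W : ℕ) (b : Fin n → (Fin m → ℤ)) : ∀ (l : ℕ) (i j : Fin n),
    (uRecCap W b l i j).natAbs < 2 ^ W
  | 0, i, j => by rw [uRecCap_zero]; exact natAbs_capZ_lt _ _
  | l + 1, i, j => by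
    by_cases h : l < n
    · rw [show l = ((⟨l, h⟩ : Fin n) : ℕ) from rfl, uRecCap_succ]; exact natAbs_capZ_lt _ _
    · rw [uRecCap_of_le W b (not_lt.1 h)]; simp

/-- Every capped `d` is short (for `W ≥ 1`). [folklore] -/
theorem natAbs_dRecCap_lt {W : ℕ} (hW : 1 ≤ W) (b : Fin n → (Fin m → ℤ)) : ∀ l : ℕ, (dRecCap W b l).natAbs < 2 ^ W
  | 0 => by simp only [dRecCap, Int.natAbs_one]; exact Nat.one_lt_two_pow (Nat.one_le_iff_ne_zero.1 hW)
  | l + 1 => by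
    show (if h : l < n then uRecCap W b l ⟨l, h⟩ ⟨l, h⟩ else 0).natAbs < 2 ^ W
    split_ifs
    · exact natAbs_uRecCap_lt _ _ _ _ _
    · simp

/-- **`reduce(k, l)` from the capped tables, with the new row capped** (the machine's `RED`).
[cite: Cohen1993, Algorithm 2.6.7 (Sub-algorithm REDI(k,l))] -/
def sizeReduceCap (W : ℕ) (b : Fin n → (Fin m → ℤ)) (k l : Fin n) : Fin n → (Fin m → ℤ) :=
  if 2 * |uRecCap W b l k l| ≤ dRecCap W b (l + 1) then b
  else update b k (capVec W
    (b k - ((2 * uRecCap W b l k l + dRecCap W b (l + 1)) / (2 * dRecCap W b (l + 1))) • b l))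

/-- The descending loop `RED(k, a-1), …, RED(k, 0)` of the machine. [cite: Cohen1993, Algorithm 2.6.7] -/
def sizeReduceFromCap (W : ℕ) (k : Fin n) : (a : ℕ) → a ≤ n → (Fin n → (Fin m → ℤ)) → (Fin n → (Fin m → ℤ))
  | 0, _, b => b
  | a + 1, h, b => sizeReduceFromCap W k a (Nat.le_of_succ_le h) (sizeReduceCap W b k ⟨a, h⟩)

/-- **One pass of the LLL machine** (functional model): `intStep` computed from the saturated
tables, the new row saturated. [cite: Cohen1993, Algorithm 2.6.7] [cite: LenstraLenstraLovasz1982, §1 Fig. 1] -/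
def capStep (W : ℕ) (s : LLLState n (Fin m → ℤ)) : LLLState n (Fin m → ℤ) :=
  if hk : 0 < s.k ∧ s.k < n then
    let k : Fin n := ⟨s.k, hk.2⟩
    let j : Fin n := ⟨s.k - 1, by omega⟩
    let b₁ : Fin n → (Fin m → ℤ) := sizeReduceCap W s.b k j
    if 3 * dRecCap W b₁ s.k ^ (2 : ℕ) ≤
        4 * (dRecCap W b₁ (s.k + 1) * dRecCap W b₁ (s.k - 1) + uRecCap W b₁ (s.k - 1) k j ^ (2 : ℕ))
    then ⟨sizeReduceFromCap W k (s.k - 1) (by omega) b₁, s.k + 1⟩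
    else ⟨b₁ ∘ Equiv.swap j k, max 1 (s.k - 1)⟩
  else if s.k < n then ⟨s.b, 1⟩
  else s

/-! ### `ℕ`-indexed list views (for the machine's loop invariants) -/

/-- `uCapN W b t i j = uRecCap W b t i j` with `ℕ` indices (junk `0` out of range). [folklore] -/
def uCapN (W : ℕ) (b : Fin n → (Fin m → ℤ)) (t i j : ℕ) : ℤ :=
  if hi : i < n then if hj : j < n then uRecCap W b t ⟨i, hi⟩ ⟨j, hj⟩ else 0 else 0

/-- `uCapN` in range. [folklore] -/
theorem uCapN_eq (W : ℕ) (b : Fin n → (Fin m → ℤ)) (t : ℕ) (i j : Fin n) :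
    uCapN W b t i j = uRecCap W b t i j := by
  simp [uCapN, i.isLt, j.isLt]

/-- Row `i` of the matrix as a list (junk `[]` out of range). [folklore] -/
def rowN (b : Fin n → (Fin m → ℤ)) (i : ℕ) : List ℤ := if h : i < n then List.ofFn (b ⟨i, h⟩) else []

/-- Rows `i, …, i + c - 1`, flattened. [folklore] -/
def rowsFromN (b : Fin n → (Fin m → ℤ)) (i c : ℕ) : List ℤ := ((List.range' i c).map (rowN b)).flatten

/-- Row `i` of the saturated `λ`-table: `λᵢ₀, …, λᵢ,ᵢ₋₁` with `λᵢⱼ = uⱼ(i,j)`. [cite: Cohen1993, Algorithm 2.6.7] -/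
def lamRowN (W : ℕ) (b : Fin n → (Fin m → ℤ)) (i : ℕ) : List ℤ := (List.range i).map fun j => uCapN W b j i j

/-- Rows `a, …, a + c - 1` of the saturated `λ`-table, flattened. [folklore] -/
def lamFlatN (W : ℕ) (b : Fin n → (Fin m → ℤ)) (a c : ℕ) : List ℤ := ((List.range' a c).map (lamRowN W b)).flatten

/-- The saturated `d`-list `d₀, …, dᵢ`. [cite: Cohen1993, Algorithm 2.6.7] -/
def dListN (W : ℕ) (b : Fin n → (Fin m → ℤ)) (i : ℕ) : List ℤ := (List.range (i + 1)).map (dRecCap W b)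

/-- Length of a row. [folklore] -/
@[simp] theorem length_rowN (b : Fin n → (Fin m → ℤ)) {i : ℕ} (hi : i < n) : (rowN b i).length = m := by
  simp [rowN, hi]

/-- `rowsFromN` unfolds one row. [folklore] -/
theorem rowsFromN_succ (b : Fin n → (Fin m → ℤ)) (i c : ℕ) : rowsFromN b i (c + 1) = rowN b i ++ rowsFromN b (i + 1) c := by
  simp [rowsFromN, List.range'_succ]

/-- `rowsFromN _ _ 0 = []`. [folklore] -/
@[simp] theorem rowsFromN_zero (b : Fin n → (Fin m → ℤ)) (i : ℕ) : rowsFromN b i 0 = [] := by simp [rowsFromN]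

/-- `lamFlatN` unfolds one row. [folklore] -/
theorem lamFlatN_succ (W : ℕ) (b : Fin n → (Fin m → ℤ)) (a c : ℕ) :
    lamFlatN W b a (c + 1) = lamRowN W b a ++ lamFlatN W b (a + 1) c := by
  simp [lamFlatN, List.range'_succ]

/-- `lamFlatN _ _ _ 0 = []`. [folklore] -/
@[simp] theorem lamFlatN_zero (W : ℕ) (b : Fin n → (Fin m → ℤ)) (a : ℕ) : lamFlatN W b a 0 = [] := by simp [lamFlatN]

/-- Length of a `λ`-row. [folklore] -/
@[simp] theorem length_lamRowN (W : ℕ) (b : Fin n → (Fin m → ℤ)) (i : ℕ) : (lamRowN W b i).length = i := by simp [lamRowN]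

/-- Length of the `d`-list. [folklore] -/
@[simp] theorem length_dListN (W : ℕ) (b : Fin n → (Fin m → ℤ)) (i : ℕ) : (dListN W b i).length = i + 1 := by simp [dListN]

/-- Appending the next `λ`. [folklore] -/
theorem lamRowN_succ (W : ℕ) (b : Fin n → (Fin m → ℤ)) (i j : ℕ) :
    (List.range (j + 1)).map (fun j' => uCapN W b j' i j') = (List.range j).map (fun j' => uCapN W b j' i j') ++ [uCapN W b j i j] := by
  simp [List.range_succ]

/-- The `d`-list without its head `d₀`. [folklore] -/
theorem dListN_drop_one (W : ℕ) (b : Fin n → (Fin m → ℤ)) (i : ℕ) :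
    (dListN W b i).drop 1 = (List.range i).map fun t => dRecCap W b (t + 1) := by
  simp [dListN, List.range_succ_eq_map, Function.comp_def]

/-- The `d`-list is `d₀` followed by the rest. [folklore] -/
theorem dListN_eq_cons (W : ℕ) (b : Fin n → (Fin m → ℤ)) (i : ℕ) :
    dListN W b i = dRecCap W b 0 :: (dListN W b i).drop 1 := by
  rw [dListN_drop_one]; simp [dListN, List.range_succ_eq_map, Function.comp_def]

/-- Appending the next `d`. [folklore] -/
theorem dListN_succ (W : ℕ) (b : Fin n → (Fin m → ℤ)) (i : ℕ) : dListN W b (i + 1) = dListN W b i ++ [dRecCap W b (i + 1)] := by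
  simp [dListN, List.range_succ]

/-- The Gram entry as a dot product of the row lists (in either common order). [folklore] -/
theorem sum_zipWith_rowN (b : Fin n → (Fin m → ℤ)) (i j : Fin n) :
    (List.zipWith (· * ·) (rowN b i).reverse (rowN b j).reverse).sum = intGram b i j := by
  have hl : (rowN b i).length = (rowN b j).length := by simp [rowN]
  rw [← List.reverse_zipWith hl, List.sum_reverse]
  simp only [rowN, Fin.is_lt, dif_pos, Fin.eta, intGram]
  rw [show List.zipWith (fun x1 x2 => x1 * x2) (List.ofFn (b i)) (List.ofFn (b j)) = List.ofFn (fun t => b i t * b j t) from ?_,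
    List.sum_ofFn]
  apply List.ext_getElem (by simp)
  intro t h₁ h₂
  simp

end Cap


/-! ### Agreement with the uncapped recursion when everything fits -/

section Agreement

variable {n m : ℕ}

/-- **All of Cohen's `uₗ(i,j)` with `l ≤ j ≤ i` are short** (absolute value `< 2^W`). The
recursion for `u_{l+1}(i,j)` only uses `uₗ(l,l)`, `uₗ(i,j)`, `uₗ(j,l)`, `uₗ(i,l)` and `dₗ`, all
again in this triangular index range, so on such a matrix the saturated recursion never
saturates there (`uRecCap_eq_uRec`). [folklore] -/
def FitsU (W : ℕ) (b : Fin n → (Fin m → ℤ)) : Prop :=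
  ∀ (l : ℕ) (i j : Fin n), l ≤ j → (j : ℕ) ≤ i → (uRec b l i j).natAbs < 2 ^ W

/-- **Everything the machine stores about `b` is short**: the triangular `u`-table and the
entries of `b`. [folklore] -/
def Fits (W : ℕ) (b : Fin n → (Fin m → ℤ)) : Prop :=
  FitsU W b ∧ ∀ (i : Fin n) (t : Fin m), (b i t).natAbs < 2 ^ W

/-- On a matrix whose triangular `u`-table is short, the saturated recursion is Cohen's
recursion there, and the saturated `d`'s are the `d`'s. [cite: Cohen1993, Algorithm 2.6.7 Step 2] -/
theorem uRecCap_eq_uRec {W : ℕ} {b : Fin n → (Fin m → ℤ)} (h : FitsU W b) :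
    ∀ (l : ℕ), (∀ (i j : Fin n), l ≤ j → (j : ℕ) ≤ i → uRecCap W b l i j = uRec b l i j) ∧
      dRecCap W b l = dRec b l
  | 0 => ⟨fun i j _ hji => by
      rw [uRecCap_zero, uRec_zero]
      have := h 0 i j (Nat.zero_le _) hji
      rw [uRec_zero] at this
      exact capZ_of_lt this, rfl⟩
  | l + 1 => by
    obtain ⟨ih, ihd⟩ := uRecCap_eq_uRec h l
    by_cases hln : l < n
    · set L : Fin n := ⟨l, hln⟩ with hL
      have hLv : (L : ℕ) = l := rfl
      refine ⟨fun i j hl hji => ?_, ?_⟩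
      · rw [← hLv, uRecCap_succ, uRec_succ, hLv, ihd, ih L L le_rfl le_rfl, ih i j (by omega) hji,
          ih j L le_rfl (by rw [hLv]; omega), ih i L le_rfl (by rw [hLv]; omega)]
        have := h (l + 1) i j hl hji
        rw [← hLv, uRec_succ, hLv] at this
        exact capZ_of_lt this
      · simp only [dRecCap, dRec, dif_pos hln]
        exact ih _ _ le_rfl le_rfl
    · refine ⟨fun i j hl _ => absurd (lt_of_lt_of_le (Nat.lt_succ_self l) (hl.trans j.isLt.le)) hln, ?_⟩
      simp only [dRecCap, dRec, dif_neg hln]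

/-- The saturated `d`'s are the `d`'s on a matrix whose triangular `u`-table is short. [folklore] -/
theorem dRecCap_eq_dRec {W : ℕ} {b : Fin n → (Fin m → ℤ)} (h : FitsU W b) (l : ℕ) :
    dRecCap W b l = dRec b l :=
  (uRecCap_eq_uRec h l).2

/-- `RED(k,l)` from the saturated tables is `RED(k,l)` when the tables of `b` are short and the
new row is short. [cite: Cohen1993, Algorithm 2.6.7 (sub-algorithm RED)] -/
theorem sizeReduceCap_eq_intSizeReduce {W : ℕ} {b : Fin n → (Fin m → ℤ)} {k l : Fin n} (hlk : l < k)
    (hb : FitsU W b) (hnew : ∀ t, (intSizeReduce b k l k t).natAbs < 2 ^ W) :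
    sizeReduceCap W b k l = intSizeReduce b k l := by
  have e1 : uRecCap W b l k l = uRec b l k l := (uRecCap_eq_uRec hb l).1 k l le_rfl hlk.le
  have e2 : dRecCap W b (l + 1) = dRec b (l + 1) := dRecCap_eq_dRec hb _
  unfold sizeReduceCap
  unfold intSizeReduce at hnew ⊢
  rw [e1, e2]
  by_cases hc : 2 * |uRec b l k l| ≤ dRec b (l + 1)
  · rw [if_pos hc, if_pos hc]
  · rw [if_neg hc, if_neg hc]
    simp only [if_neg hc, update_self] at hnew
    congr 1
    funext t
    exact capZ_of_lt (hnew t)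

/-- The matrices met by the descending loop `RED(k,a-1), …, RED(k,0)` started from `b`: the
matrix after each `RED`, in execution order. [cite: Cohen1993, Algorithm 2.6.7] -/
def intRedChain (k : Fin n) : (a : ℕ) → a ≤ n → (Fin n → (Fin m → ℤ)) → List (Fin n → (Fin m → ℤ))
  | 0, _, _ => []
  | a + 1, h, b => intSizeReduce b k ⟨a, h⟩ :: intRedChain k a (Nat.le_of_succ_le h) (intSizeReduce b k ⟨a, h⟩)

/-- **The matrices met during the pass `intStep s`** (those whose tables and rows the machine
stores): the current matrix, the matrix after `RED(k,k-1)`, and the matrices of the descending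
loop (listed whether or not the Lovász test sends the pass that way). Empty when the pass does
no arithmetic (`k = 0` or halted). [cite: Cohen1993, Algorithm 2.6.7] -/
def intPassMatrices (s : LLLState n (Fin m → ℤ)) : List (Fin n → (Fin m → ℤ)) :=
  if hk : 0 < s.k ∧ s.k < n then
    s.b :: intSizeReduce s.b ⟨s.k, hk.2⟩ ⟨s.k - 1, by omega⟩ ::
      intRedChain ⟨s.k, hk.2⟩ (s.k - 1) (by omega) (intSizeReduce s.b ⟨s.k, hk.2⟩ ⟨s.k - 1, by omega⟩)
  else []

/-- The saturated descending loop is the descending loop when its input and every matrix it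
meets fit. [cite: Cohen1993, Algorithm 2.6.7] -/
theorem sizeReduceFromCap_eq_intSizeReduceFrom {W : ℕ} (k : Fin n) :
    ∀ (a : ℕ) (ha : a ≤ n) (_ : a ≤ k) (b : Fin n → (Fin m → ℤ)),
      FitsU W b → (∀ c ∈ intRedChain k a ha b, Fits W c) →
        sizeReduceFromCap W k a ha b = intSizeReduceFrom k a ha b
  | 0, _, _, _, _, _ => rfl
  | a + 1, ha, hak, b, hb, hc => by
    have hlk : (⟨a, ha⟩ : Fin n) < k := Fin.mk_lt_of_lt_val hak
    have hmem : intSizeReduce b k ⟨a, ha⟩ ∈ intRedChain k (a + 1) ha b := by simp [intRedChain]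
    obtain ⟨hU, hE⟩ := hc _ hmem
    rw [sizeReduceFromCap, intSizeReduceFrom, sizeReduceCap_eq_intSizeReduce hlk hb (hE k)]
    exact sizeReduceFromCap_eq_intSizeReduceFrom k a _ (Nat.le_of_succ_le hak) _ hU
      fun c hc' => hc c (by simp [intRedChain, hc'])

/-- **The saturated pass is the integral pass when every matrix met during the pass fits.**
(On lattice bases along the run this holds for `W = O(n log B)`: LLL82, proof of Prop. 1.26.)
[cite: Cohen1993, Algorithm 2.6.7] [cite: LenstraLenstraLovasz1982, Prop. 1.26 (proof)] -/
theorem capStep_eq_intStep {W : ℕ} (s : LLLState n (Fin m → ℤ))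
    (h : ∀ c ∈ intPassMatrices s, Fits W c) : capStep W s = intStep s := by
  unfold capStep intStep
  by_cases hk : 0 < s.k ∧ s.k < n
  · simp only [intPassMatrices, dif_pos hk] at h
    rw [dif_pos hk, dif_pos hk]
    dsimp only
    set k : Fin n := ⟨s.k, hk.2⟩ with hkdef
    set j : Fin n := ⟨s.k - 1, by omega⟩ with hjdef
    have hjk : j < k := Fin.mk_lt_mk.2 (by omega)
    have h0 : Fits W s.b := h _ (by simp)
    have h1 : Fits W (intSizeReduce s.b k j) := h _ (by simp)
    have hred : sizeReduceCap W s.b k j = intSizeReduce s.b k j :=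
      sizeReduceCap_eq_intSizeReduce hjk h0.1 (h1.2 k)
    rw [hred]
    set b₁ := intSizeReduce s.b k j with hb₁
    have hd : ∀ l, dRecCap W b₁ l = dRec b₁ l := dRecCap_eq_dRec h1.1
    have hu : uRecCap W b₁ (s.k - 1) k j = uRec b₁ (s.k - 1) k j :=
      (uRecCap_eq_uRec h1.1 (s.k - 1)).1 k j (by rw [hjdef]) hjk.le
    rw [hd, hd, hd, hu, sizeReduceFromCap_eq_intSizeReduceFrom k (s.k - 1) _ (by simp [hkdef]) b₁ h1.1
      fun c hc => h c (by simp [hc])]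
  · rw [dif_neg hk, dif_neg hk]

end Agreement

end Literature.Algebra.EuclideanLattices
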